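import Mathlib
import Literature.Computability.Complexity.RangeAvoidance
import Literature.Computability.Complexity.SignDegreeXor
import Summits.PneNP.PneNP.Theorems.PstarExpandingModel

/-!
# Random typed `P⋆` instances, II: the union bound (counting)

FRONTIER range-avoidance ladder, ROUND-21 item T21.1′ (cell `pnp-ideate`; restricted-model combinatorics — nothing here
bears on `P` vs `NP`).  Counting form of the first-moment method for `PstarExpandingModel.inst`:

* `bad r ω` — some set of `≤ r` outputs of `inst ω` reads fewer than `11/4·|J|` variables; `boundaryExpanding_of_not_bad`;
* `cylJ J A B` — outcomes whose outputs in `J` have XOR pair in `A` and AND pair in `B`; `card_cylJ` (product count);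
* `badSet_subset` — every bad outcome lies in some `cylJ J A B` with `|J| = s ∈ [1, r]`, `|A| + |B| = vOf s`
  (`vOf s = 3s − ⌈s/4⌉ = ⌊11s/4⌋`), provided `3r ≤ N`;
* `card_pairsOf_le` — at most `C(2N, v)` pairs `(A, B)` with `|A| + |B| = v`;
* `card_badSet_le` — the union bound as a real inequality:
  `|bad| ≤ Σ_{i<r} C(m, i+1)·C(2N, vOf(i+1))·(vOf(i+1)⁴/16)^{i+1}·Q^{m−(i+1)}`, `Q = |DPair N|²`.
-/

set_option linter.dupNamespace false

open Finset Literature.Computability.Complexity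
open Summit.PneNP.PneNP.Theorems.PstarSALevel (varSet bdry BoundaryExpanding)
open Summit.PneNP.PneNP.Theorems.PstarSAClosure (nbhd)
open Summit.PneNP.PneNP.Theorems.PstarExpandingModel

namespace Summit.PneNP.PneNP.Theorems.PstarExpandingCount

variable {N m : ℕ}

/-! ## Bad outcomes -/

/-- An outcome is BAD at radius `r` if some `≤ r` outputs read fewer than `11/4` variables each on average. -/
def bad (r : ℕ) (ω : Outcome N m) : Prop :=
  ∃ J : Finset (Fin m), J.card ≤ r ∧ ¬(11 * J.card ≤ 4 * (nbhd (inst ω) J).card)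

/-- A good outcome gives an `(r, 3/2)`-boundary expanding instance. -/
theorem boundaryExpanding_of_not_bad (r : ℕ) (ω : Outcome N m) (h : ¬bad r ω) : BoundaryExpanding r (inst ω) := by
  refine boundaryExpanding_of_vertexExpanding (inst ω) (fun j => slots_injective (ω j)) r fun J hJ => ?_
  by_contra hlt
  exact h ⟨J, hJ, hlt⟩

/-- The threshold `vOf s = 3s − ⌈s/4⌉ = ⌊11s/4⌋`. -/
def vOf (s : ℕ) : ℕ := 3 * s - (s + 3) / 4

/-- `⌈s/4⌉ ≤ 3s`. -/
theorem qOf_le (s : ℕ) : (s + 3) / 4 ≤ 3 * s ∨ s = 0 := by omega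

/-- `vOf s + ⌈s/4⌉ = 3s`. -/
theorem vOf_add (s : ℕ) : vOf s + (s + 3) / 4 = 3 * s := by unfold vOf; omega

/-- A bad set of size `s` reads at most `vOf s` variables: `4V < 11s ⇒ V ≤ vOf s`. -/
theorem le_vOf_of_lt {s V : ℕ} (h : ¬(11 * s ≤ 4 * V)) : V ≤ vOf s := by unfold vOf; omega

/-- `vOf s ≤ 3s`. -/
theorem vOf_le (s : ℕ) : vOf s ≤ 3 * s := by unfold vOf; omega

/-! ## Cylinders and their size -/

/-- Outcomes whose outputs in `J` have XOR pair inside `A` and AND pair inside `B`. -/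
def cylJ (J : Finset (Fin m)) (A B : Finset (Fin N)) : Finset (Outcome N m) :=
  Fintype.piFinset fun j => if j ∈ J then qset A B else univ

/-- Membership in a cylinder. -/
theorem mem_cylJ {J : Finset (Fin m)} {A B : Finset (Fin N)} {ω : Outcome N m} :
    ω ∈ cylJ J A B ↔ ∀ j ∈ J, ω j ∈ qset A B := by
  simp only [cylJ, Fintype.mem_piFinset]
  constructor
  · intro h j hj
    have := h j
    rwa [if_pos hj] at this
  · intro h j
    by_cases hj : j ∈ J
    · rw [if_pos hj]; exact h j hj
    · rw [if_neg hj]; exact Finset.mem_univ _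

/-- **Product count**: `|cylJ J A B| = |qset A B|^{|J|} · Q^{m − |J|}`, `Q = |DPair N × DPair N|`. -/
theorem card_cylJ (J : Finset (Fin m)) (A B : Finset (Fin N)) :
    (cylJ J A B).card = (qset A B).card ^ J.card * (Fintype.card (DPair N × DPair N)) ^ (m - J.card) := by
  classical
  unfold cylJ
  rw [Fintype.card_piFinset]
  have h : ∀ j : Fin m, (if j ∈ J then qset A B else (univ : Finset (DPair N × DPair N))).card =
      if j ∈ J then (qset A B).card else Fintype.card (DPair N × DPair N) := by
    intro j; split_ifs <;> simp
  simp_rw [h]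
  rw [Finset.prod_ite, Finset.prod_const, Finset.prod_const]
  congr 2
  · rw [Finset.filter_mem_eq_inter, Finset.univ_inter]
  · rw [Finset.filter_not, Finset.filter_mem_eq_inter, Finset.univ_inter, Finset.card_univ_sdiff, Fintype.card_fin]

/-! ## The containment of the bad set -/

/-- The pairs `(A, B)` of vertex sets with `|A| + |B| = v`. -/
def pairsOf (N v : ℕ) : Finset (Finset (Fin N) × Finset (Fin N)) :=
  univ.filter fun AB => AB.1.card + AB.2.card = v

/-- The bad outcomes. -/
noncomputable def badSet (N m r : ℕ) : Finset (Outcome N m) := by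
  classical exact univ.filter fun ω => bad r ω

/-- The covering family: over sizes `s = i + 1`, `i < r`, sets `J` of that size and pairs of total size `vOf s`. -/
def cover (N m r : ℕ) : Finset (Outcome N m) :=
  (Finset.range r).biUnion fun i => (univ.powersetCard (i + 1)).biUnion fun J =>
    (pairsOf N (vOf (i + 1))).biUnion fun AB => cylJ J AB.1 AB.2

/-- **Containment**: if `3r ≤ N`, every bad outcome lies in the cover. -/
theorem badSet_subset (r : ℕ) (hr : 3 * r ≤ N) : badSet N m r ⊆ cover N m r := by
  classical
  intro ω hω
  simp only [badSet, Finset.mem_filter, Finset.mem_univ, true_and] at hω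
  obtain ⟨J, hJr, hJ⟩ := hω
  have hs : 1 ≤ J.card := by
    rw [Nat.one_le_iff_ne_zero]
    intro h0
    rw [Finset.card_eq_zero] at h0
    subst h0
    exact hJ (by simp)
  have hV : (nbhd (inst ω) J).card ≤ vOf J.card := le_vOf_of_lt hJ
  have hvN : vOf J.card ≤ N := (vOf_le _).trans (by omega)
  obtain ⟨A, B, hAB, hmem⟩ := exists_pair_of_small_nbhd ω J (vOf J.card) hvN hV
  simp only [cover, Finset.mem_biUnion, Finset.mem_range, Finset.mem_powersetCard]
  refine ⟨J.card - 1, by omega, J, ⟨Finset.subset_univ _, by omega⟩, (A, B), ?_, ?_⟩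
  · simp only [pairsOf, Finset.mem_filter, Finset.mem_univ, true_and]
    rw [hAB]; congr 1; omega
  · exact mem_cylJ.2 hmem

/-! ## Counting the pairs `(A, B)` -/

/-- At most `C(2N, v)` pairs of vertex sets have total size `v` (inject `(A, B) ↦ A ⊎ B`). -/
theorem card_pairsOf_le (N v : ℕ) : (pairsOf N v).card ≤ (N + N).choose v := by
  classical
  have h : (pairsOf N v).card ≤ ((univ : Finset (Fin N ⊕ Fin N)).powersetCard v).card := by
    refine Finset.card_le_card_of_injOn (fun AB => AB.1.disjSum AB.2) ?_ ?_
    · intro AB hAB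
      have hAB' : AB.1.card + AB.2.card = v := by
        simpa [pairsOf] using hAB
      rw [Finset.mem_coe, Finset.mem_powersetCard, Finset.card_disjSum]
      exact ⟨Finset.subset_univ _, hAB'⟩
    · intro AB _ AB' _ h
      simp only at h
      have h1 : AB.1 = AB'.1 := by
        ext a
        have := congrArg (fun S => (Sum.inl a : Fin N ⊕ Fin N) ∈ S) h
        simpa using this
      have h2 : AB.2 = AB'.2 := by
        ext b
        have := congrArg (fun S => (Sum.inr b : Fin N ⊕ Fin N) ∈ S) h
        simpa using this
      exact Prod.ext h1 h2
  refine h.trans ?_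
  rw [Finset.card_powersetCard, Finset.card_univ, Fintype.card_sum, Fintype.card_fin]

/-! ## The union bound -/

/-- Size of a cylinder over a pair of total size `v`, in `ℝ`: `≤ (v⁴/16)^{|J|} · Q^{m − |J|}`. -/
theorem card_cylJ_le (J : Finset (Fin m)) {A B : Finset (Fin N)} {v : ℕ} (hAB : A.card + B.card = v) :
    ((cylJ J A B).card : ℝ) ≤ ((v : ℝ) ^ 4 / 16) ^ J.card * (Fintype.card (DPair N × DPair N) : ℝ) ^ (m - J.card) := by
  rw [card_cylJ]
  push_cast
  refine mul_le_mul_of_nonneg_right (pow_le_pow_left₀ (by positivity) ?_ _) (by positivity)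
  have h1 := card_qset_le A B
  have h2 := sixteen_mul_sq_le A.card B.card
  rw [hAB] at h2
  have h3 : (16 : ℝ) * (qset A B).card ≤ (v : ℝ) ^ 4 := by
    have : 16 * (qset A B).card ≤ v ^ 4 := by
      calc 16 * (qset A B).card ≤ 16 * (A.card * B.card) ^ 2 := Nat.mul_le_mul_left _ h1
        _ ≤ v ^ 4 := h2
    exact_mod_cast this
  linarith

/-- **The union bound.**  If `3r ≤ N` then
`|bad| ≤ Σ_{i<r} C(m, i+1)·C(2N, vOf(i+1))·(vOf(i+1)⁴/16)^{i+1}·Q^{m−(i+1)}`. -/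
theorem card_badSet_le (r : ℕ) (hr : 3 * r ≤ N) :
    ((badSet N m r).card : ℝ) ≤ ∑ i ∈ Finset.range r,
      (m.choose (i + 1) : ℝ) * ((N + N).choose (vOf (i + 1)) : ℝ) * ((vOf (i + 1) : ℝ) ^ 4 / 16) ^ (i + 1) *
        (Fintype.card (DPair N × DPair N) : ℝ) ^ (m - (i + 1)) := by
  classical
  have h0 : ((badSet N m r).card : ℝ) ≤ ((cover N m r).card : ℝ) := by
    exact_mod_cast Finset.card_le_card (badSet_subset r hr)
  refine h0.trans ?_
  unfold cover
  refine (Nat.cast_le.2 Finset.card_biUnion_le).trans ?_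
  push_cast
  refine Finset.sum_le_sum fun i _ => ?_
  refine (Nat.cast_le (α := ℝ).2 Finset.card_biUnion_le).trans ?_
  push_cast
  -- sum over J of size i+1
  have hJ : ∀ J ∈ (univ : Finset (Fin m)).powersetCard (i + 1),
      (((pairsOf N (vOf (i + 1))).biUnion fun AB => cylJ J AB.1 AB.2).card : ℝ) ≤
        ((N + N).choose (vOf (i + 1)) : ℝ) * ((vOf (i + 1) : ℝ) ^ 4 / 16) ^ (i + 1) *
          (Fintype.card (DPair N × DPair N) : ℝ) ^ (m - (i + 1)) := by
    intro J hJ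
    rw [Finset.mem_powersetCard] at hJ
    refine (Nat.cast_le (α := ℝ).2 Finset.card_biUnion_le).trans ?_
    push_cast
    have hterm : ∀ AB ∈ pairsOf N (vOf (i + 1)), ((cylJ J AB.1 AB.2).card : ℝ) ≤
        ((vOf (i + 1) : ℝ) ^ 4 / 16) ^ (i + 1) * (Fintype.card (DPair N × DPair N) : ℝ) ^ (m - (i + 1)) := by
      intro AB hAB
      simp only [pairsOf, Finset.mem_filter, Finset.mem_univ, true_and] at hAB
      have := card_cylJ_le (m := m) J hAB
      rwa [hJ.2] at this
    refine (Finset.sum_le_sum hterm).trans ?_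
    rw [Finset.sum_const, nsmul_eq_mul]
    have hp : ((pairsOf N (vOf (i + 1))).card : ℝ) ≤ ((N + N).choose (vOf (i + 1)) : ℝ) := by
      exact_mod_cast card_pairsOf_le N (vOf (i + 1))
    have hnn : (0 : ℝ) ≤ ((vOf (i + 1) : ℝ) ^ 4 / 16) ^ (i + 1) *
        (Fintype.card (DPair N × DPair N) : ℝ) ^ (m - (i + 1)) := by positivity
    nlinarith
  refine (Finset.sum_le_sum hJ).trans ?_
  have hc : ((univ : Finset (Fin m)).powersetCard (i + 1)).card = m.choose (i + 1) := by
    rw [Finset.card_powersetCard, Finset.card_univ, Fintype.card_fin]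
  rw [Finset.sum_const, nsmul_eq_mul, hc]
  exact le_of_eq (by ring)

end Summit.PneNP.PneNP.Theorems.PstarExpandingCount
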